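import Summits.QuantumFields.YangMills.Theorems.BackwardLiouvilleRigidityAdmFRFrameInhabited
import Summits.QuantumFields.YangMills.Theorems.SmallFieldWideningLargeFieldMassRefinementTailSeriesTail
import Summits.QuantumFields.YangMills.Theorems.SmallFieldWideningLargeFieldMassRefinementTailMassOfPerPlaquette
import Literature.MathematicalPhysics.QuantumFieldTheory.Balaban1983to89.B10Eq41TorusHistories
import Literature.MathematicalPhysics.QuantumFieldTheory.Balaban1983to89.B10StarCount
import HarnessLib

/-!
# Route `BackwardLiouvilleRigidity` — the non-vacuity frame with a FLOOR-CLASS tail profile (`admFR_frame_inhabited_block_floorTail`)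

Companion of `BackwardLiouvilleRigidityAdmFRFrameInhabited` (tribunal J r8 ∕ director-ym R606 ORDER (2), stmt-QuantumFields-28294).  There the
per-height hypothesis block of `BackwardStabilityAdmFR` was inhabited at every height by the Wilson run `K = j` read at its finest level,
with the tail bound either trivial (`η_j ≥ 1`) or the tree's geometric bare tail profile (`T3BareTailProfile.bareTailAt`, ratio `½`).  The
crux also puts FOUR standing conditions on `η`: `0 ≤ η`, `Summable η`, `Summable (fun i => ∑' k, η (k + i))` and the FLOOR-CLASS condition
`(∑' k, η (k + j))·((1 + 2(L^j∕γ)·#Plaq_j)·#PBond_j²) → 0`.  A geometric profile of ratio `½` fails the last one (the bracket grows like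
`L^{10j}`); the finest-height large-field estimate behind it (`T3FinestHeightTail.gibbsK_real_not_plaqSmall_le`, [Balaban1985UV3] (71) at the
finest height: reflection positivity + chessboard + small Haar balls) is Gaussian in the height, `≲ L^{8K}·exp(−b₀²(log L)²K²∕16)`, and
therefore dominates a geometric profile of ANY ratio — here `L^{−11}`, which beats `L^{10}`.

Statements: `admFR_frame_inhabited_printedSchedule` (the frame along EVERY printed schedule `C₀ ≥ 0`, not a corner), `floorTailProfile` (a profile `η_K = A·L^{−11K}` with all four standing conditions AND `Gibbs_K{¬PlaqSmall θ_K} ≤ η_K` for every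
`K`, `1 ≤ p₀`), `admFR_frame_inhabited_block_floorTail` (the per-height hypothesis block of 28294 VERBATIM at the Wilson runs read at their
finest levels, with this `η` and every `ω ≥ 0`: every standing hypothesis of `BackwardStabilityAdmFR` on `(prm, ω, η, μ, μ', ρ, ρ')` except
the tower consistency `μ j = (descend F ℰp j)_* μ (j+1)` is then met simultaneously).

HONEST SCOPE.  Zero renormalisation steps, as in the companion; the consistent tower of members is `ClassLimitTrajectoriesAdmFR`'s content;
nothing of 28294∕28295∕28296 is proved; rung R3 (`YM3TorusSU2`) and every summit statement stay OPEN; the Yang–Mills mass gap is NOT proved.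
-/

namespace Summit.QuantumFields.YangMills.Theorems.AdmFRFrameFloorTail

open Filter Topology MeasureTheory
open Literature.MathematicalPhysics.QuantumFieldTheory.Balaban1983to89 T3ContinuumYM3Torus T3NestedUnitLaws T3UnitLawDensityEML
  T3UnitScaleTilt BalabanUVClass Missing

/-! ## §1 Counting (the arithmetic helpers `quadratic_le_sq_div`, `sqrt_pow_nine_le_pow_five` are the tree's, `LargeFieldMassRefinementTail`) -/

/-- The number of plaquettes of the finest lattice of run `K`: `3·(2L^{m+K})³`. [cite: Balaban1985UV3, (1)-(3) p.256] -/
theorem card_plaq_zero (F : T3Family) (K : ℕ) :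
    (Fintype.card (Plaq (F.P K) 0) : ℝ) = 24 * (F.L : ℝ) ^ (3 * F.m) * ((F.L : ℝ) ^ K) ^ 3 := by
  rw [B10Eq41TorusHistories.card_plaq_three rfl, Site.card_site,
    show (F.P K).sitesPerDir 0 = 2 * F.L ^ (F.m + K) by simp [Params.sitesPerDir], T3Family.P_d]
  push_cast
  ring

set_option maxHeartbeats 400000 in
/-- The number of bonds of the finest lattice of run `K`: `3·(2L^{m+K})³`. [cite: Balaban1985Averaging, (5) p.18] -/
theorem card_pbond_zero (F : T3Family) (K : ℕ) :
    (Fintype.card (PBond (F.P K) 0) : ℝ) = 24 * (F.L : ℝ) ^ (3 * F.m) * ((F.L : ℝ) ^ K) ^ 3 := by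
  rw [B10StarCount.card_pbond, Site.card_site,
    show (F.P K).sitesPerDir 0 = 2 * F.L ^ (F.m + K) by simp [Params.sitesPerDir], T3Family.P_d]
  push_cast
  ring

/-! ## §2 The floor-class bare tail profile of the runs -/

set_option maxHeartbeats 400000 in
/-- **THE FINEST-HEIGHT LARGE-FIELD TAILS OF THE RUNS ARE BELOW A GEOMETRIC PROFILE OF RATIO `L^{−11}`** (`0 < γ ≤ 1`, `0 < b₀`, `1 ≤ p₀`):
`Gibbs_K{U : ¬PlaqSmall θ(K) U} ≤ A·L^{−11K}` for every run `K` — from the tree's `gibbsK_real_not_plaqSmall_le`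
(`≤ #Plaq · 2e^{24}c⁻³ (√β_K)⁹ e^{−p(g_K)²∕4}`) and `p(g_K) ≥ ½b₀K log L`: the Gaussian `e^{−b₀²(log L)²K²∕16}` beats `L^{8K}·L^{11K}` (the
arithmetic of `T3BareTailProfile.bareTailAt` with ratio `L^{−11}` in place of `½`). [cite: Balaban1985UV3, (7) p.257 and (71) p.273] -/
theorem gibbsK_tail_le_geometric (F : T3Family) {γ b₀ p₀ : ℝ} (hγ : 0 < γ) (hγ1 : γ ≤ 1) (hb₀ : 0 < b₀) (hp₀ : 1 ≤ p₀) :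
    ∃ A : ℝ, 0 ≤ A ∧ ∀ K, (gibbsK F ℰp γ K).real {U | ¬ PlaqSmall (θBal F.L γ b₀ p₀ K) U} ≤ A * (((F.L : ℝ)⁻¹) ^ 11) ^ K := by
  obtain ⟨C, hC, -, hbound⟩ := T3FinestHeightTail.gibbsK_real_not_plaqSmall_le
  have hL1 : (1 : ℝ) < F.L := by exact_mod_cast F.hL.2
  have hL0 : (0 : ℝ) < F.L := one_pos.trans hL1
  set ℓ : ℝ := Real.log F.L with hℓ
  have hℓ0 : 0 < ℓ := Real.log_pos hL1
  have hlogγ : Real.log γ ≤ 0 := Real.log_nonpos hγ.le hγ1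
  set a : ℝ := b₀ ^ 2 * ℓ ^ 2 / 16 with ha
  have ha0 : 0 < a := by positivity
  set b : ℝ := 19 * ℓ with hb
  set A : ℝ := 48 * Real.exp 24 * (C ^ 3)⁻¹ * (F.L : ℝ) ^ (3 * F.m) * γ⁻¹ ^ 5 * Real.exp (b ^ 2 / (4 * a)) with hA
  refine ⟨A, by positivity, fun K => ?_⟩
  set r : ℝ := ((F.L : ℝ)⁻¹) ^ 11 with hr
  set x : ℝ := γ * ((F.L : ℝ)⁻¹) ^ K with hx
  have hLK : (1 : ℝ) ≤ (F.L : ℝ) ^ K := one_le_pow₀ hL1.le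
  have hLK0 : (0 : ℝ) < (F.L : ℝ) ^ K := pow_pos hL0 K
  have hinvK : ((F.L : ℝ)⁻¹) ^ K = ((F.L : ℝ) ^ K)⁻¹ := by rw [inv_pow]
  have hx0 : 0 < x := by rw [hx, hinvK]; positivity
  have hx1 : x ≤ 1 := by
    rw [hx, hinvK]
    calc γ * ((F.L : ℝ) ^ K)⁻¹ ≤ 1 * 1 := by
          gcongr; exact inv_le_one_of_one_le₀ hLK
      _ = 1 := one_mul 1
  have hxinv : x⁻¹ = γ⁻¹ * (F.L : ℝ) ^ K := by rw [hx, hinvK, mul_inv, inv_inv]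
  set g : ℝ := Real.sqrt x with hg
  have hg0 : 0 < g := Real.sqrt_pos.mpr hx0
  have hlogg : Real.log g⁻¹ = (K * ℓ - Real.log γ) / 2 := by
    rw [Real.log_inv, hg, Real.log_sqrt hx0.le, hx, Real.log_mul hγ.ne' (pow_ne_zero _ (inv_ne_zero hL0.ne')),
      Real.log_pow, Real.log_inv]
    ring
  set u : ℝ := 1 + Real.log g⁻¹ with hu
  have hu1 : 1 ≤ u := by
    rw [hu, hlogg]
    have : 0 ≤ (K : ℝ) * ℓ := by positivity
    linarith
  have huK : (K : ℝ) * ℓ / 2 ≤ u := by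
    rw [hu, hlogg]; linarith
  have hpF : B10.pFun b₀ p₀ g = b₀ * u ^ p₀ := rfl
  have hup : u ≤ u ^ p₀ := Real.self_le_rpow_of_one_le hu1 hp₀
  have hpF_ge : b₀ * ((K : ℝ) * ℓ / 2) ≤ B10.pFun b₀ p₀ g := by
    rw [hpF]
    calc b₀ * ((K : ℝ) * ℓ / 2) ≤ b₀ * u := by gcongr
      _ ≤ b₀ * u ^ p₀ := by gcongr
  have hpF0 : 0 ≤ B10.pFun b₀ p₀ g := le_trans (by positivity) hpF_ge
  have hexp : Real.exp (-(B10.pFun b₀ p₀ g ^ 2 / 4)) ≤ Real.exp (-(a * (K : ℝ) ^ 2)) := by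
    refine Real.exp_le_exp.mpr ?_
    have hsq : (b₀ * ((K : ℝ) * ℓ / 2)) ^ 2 ≤ B10.pFun b₀ p₀ g ^ 2 :=
      pow_le_pow_left₀ (by positivity) hpF_ge 2
    have : a * (K : ℝ) ^ 2 = (b₀ * ((K : ℝ) * ℓ / 2)) ^ 2 / 4 := by rw [ha]; ring
    rw [this]
    linarith
  have hβ : (F.scheme ℰp γ).β K = x⁻¹ := rfl
  have hβ1 : 1 ≤ x⁻¹ := one_le_inv_iff₀.mpr ⟨hx0, hx1⟩
  have hβ1' : 1 ≤ (F.scheme ℰp γ).β K := by rw [hβ]; exact hβ1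
  have hsqrt : Real.sqrt ((F.scheme ℰp γ).β K) ^ 9 ≤ γ⁻¹ ^ 5 * ((F.L : ℝ) ^ K) ^ 5 := by
    rw [hβ]
    calc Real.sqrt x⁻¹ ^ 9 ≤ (x⁻¹) ^ 5 := LargeFieldMassRefinementTail.sqrt_pow_nine_le_pow_five hβ1
      _ = γ⁻¹ ^ 5 * ((F.L : ℝ) ^ K) ^ 5 := by rw [hxinv]; ring
  -- `L^{8K} e^{−aK²} ≤ e^{b²/4a} L^{−11K}`
  have hLpow : ((F.L : ℝ) ^ K) ^ 8 = Real.exp (8 * ((K : ℝ) * ℓ)) := by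
    rw [← pow_mul, hℓ, show 8 * ((K : ℝ) * Real.log F.L) = ((K * 8 : ℕ) : ℝ) * Real.log F.L by push_cast; ring,
      Real.exp_nat_mul, Real.exp_log hL0]
  have hrK : r ^ K = Real.exp (-(11 * ((K : ℝ) * ℓ))) := by
    rw [hr, ← pow_mul, inv_pow, hℓ, Real.exp_neg,
      show 11 * ((K : ℝ) * Real.log F.L) = ((11 * K : ℕ) : ℝ) * Real.log F.L by push_cast; ring,
      Real.exp_nat_mul, Real.exp_log hL0]
  have hgauss : ((F.L : ℝ) ^ K) ^ 8 * Real.exp (-(a * (K : ℝ) ^ 2)) ≤ Real.exp (b ^ 2 / (4 * a)) * r ^ K := by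
    rw [hLpow, hrK, ← Real.exp_add, ← Real.exp_add]
    refine Real.exp_le_exp.mpr ?_
    have hq := LargeFieldMassRefinementTail.quadratic_le_sq_div ha0 b (K : ℝ)
    rw [hb] at hq ⊢
    nlinarith
  -- assemble
  refine (hbound F γ hγ b₀ p₀ K hβ1' hpF0).trans ?_
  rw [card_plaq_zero]
  have step1 : 24 * (F.L : ℝ) ^ (3 * F.m) * ((F.L : ℝ) ^ K) ^ 3 *
      (2 * Real.exp 24 * (C ^ 3)⁻¹ * Real.sqrt ((F.scheme ℰp γ).β K) ^ 9 * Real.exp (-(B10.pFun b₀ p₀ g ^ 2 / 4))) ≤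
      24 * (F.L : ℝ) ^ (3 * F.m) * ((F.L : ℝ) ^ K) ^ 3 *
        (2 * Real.exp 24 * (C ^ 3)⁻¹ * (γ⁻¹ ^ 5 * ((F.L : ℝ) ^ K) ^ 5) * Real.exp (-(a * (K : ℝ) ^ 2))) := by
    gcongr
  refine step1.trans ?_
  have step2 : 24 * (F.L : ℝ) ^ (3 * F.m) * ((F.L : ℝ) ^ K) ^ 3 *
      (2 * Real.exp 24 * (C ^ 3)⁻¹ * (γ⁻¹ ^ 5 * ((F.L : ℝ) ^ K) ^ 5) * Real.exp (-(a * (K : ℝ) ^ 2))) =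
      (48 * Real.exp 24 * (C ^ 3)⁻¹ * (F.L : ℝ) ^ (3 * F.m) * γ⁻¹ ^ 5) *
        (((F.L : ℝ) ^ K) ^ 8 * Real.exp (-(a * (K : ℝ) ^ 2))) := by
    ring
  rw [step2]
  calc (48 * Real.exp 24 * (C ^ 3)⁻¹ * (F.L : ℝ) ^ (3 * F.m) * γ⁻¹ ^ 5) *
        (((F.L : ℝ) ^ K) ^ 8 * Real.exp (-(a * (K : ℝ) ^ 2)))
      ≤ (48 * Real.exp 24 * (C ^ 3)⁻¹ * (F.L : ℝ) ^ (3 * F.m) * γ⁻¹ ^ 5) *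
          (Real.exp (b ^ 2 / (4 * a)) * r ^ K) := by gcongr
    _ = A * r ^ K := by rw [hA]; ring

/-- **A GEOMETRIC PROFILE OF RATIO `L^{−11}` IS IN THE FLOOR CLASS**: `A·L^{−11j}·((1 + 2(L^j∕γ)·#Plaq_j)·#PBond_j²) → 0` — the bracket is
`≤ D·L^{10j}` (`#Plaq_j = #PBond_j = 24L^{3m}L^{3j}` on the height-`j` lattice). [cite: Balaban1985UV3, (1)-(3) p.256] -/
theorem tendsto_geometric_mul_floorBracket (F : T3Family) {γ : ℝ} (hγ : 0 < γ) (A : ℝ) (hA : 0 ≤ A) :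
    Tendsto (fun j => A * (((F.L : ℝ)⁻¹) ^ 11) ^ j * ((1 + 2 * ((F.L : ℝ) ^ j / γ) * (Fintype.card (Plaq (F.P j) 0) : ℝ)) *
        (Fintype.card (PBond (F.P j) 0) : ℝ) ^ 2)) atTop (𝓝 0) := by
  have hL1 : (1 : ℝ) < F.L := by exact_mod_cast F.hL.2
  have hL0 : (0 : ℝ) < F.L := one_pos.trans hL1
  simp_rw [card_plaq_zero, card_pbond_zero]
  set D : ℝ := (1 + 2 * γ⁻¹ * (24 * (F.L : ℝ) ^ (3 * F.m))) * (24 * (F.L : ℝ) ^ (3 * F.m)) ^ 2 with hD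
  have hD0 : 0 ≤ D := by positivity
  have hq : Tendsto (fun j : ℕ => A * D * ((F.L : ℝ)⁻¹) ^ j) atTop (𝓝 0) := by
    simpa using (tendsto_pow_atTop_nhds_zero_of_lt_one (inv_nonneg.mpr hL0.le) (inv_lt_one_of_one_lt₀ hL1)).const_mul (A * D)
  refine squeeze_zero (fun j => by positivity) (fun j => ?_) hq
  have hLj : (1 : ℝ) ≤ (F.L : ℝ) ^ j := one_le_pow₀ hL1.le
  have hLj0 : (0 : ℝ) < (F.L : ℝ) ^ j := pow_pos hL0 j
  -- `L^{-11j} · L^{10j} = L^{-j}`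
  have hrj : (((F.L : ℝ)⁻¹) ^ 11) ^ j * ((F.L : ℝ) ^ j) ^ 10 = ((F.L : ℝ)⁻¹) ^ j := by
    rw [← pow_mul, inv_pow, inv_pow, ← pow_mul, show 11 * j = j + j * 10 by ring, pow_add, mul_inv, mul_assoc,
      inv_mul_cancel₀ (pow_ne_zero _ hL0.ne'), mul_one]
  -- the bracket is `≤ D·L^{10j}`
  have hbr : (1 + 2 * ((F.L : ℝ) ^ j / γ) * (24 * (F.L : ℝ) ^ (3 * F.m) * ((F.L : ℝ) ^ j) ^ 3)) *
      (24 * (F.L : ℝ) ^ (3 * F.m) * ((F.L : ℝ) ^ j) ^ 3) ^ 2 ≤ D * ((F.L : ℝ) ^ j) ^ 10 := by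
    have h4 : (1 : ℝ) ≤ ((F.L : ℝ) ^ j) ^ 4 := one_le_pow₀ hLj
    have hc : 0 ≤ 2 * γ⁻¹ * (24 * (F.L : ℝ) ^ (3 * F.m)) * ((F.L : ℝ) ^ j) ^ 4 := by positivity
    have h1' : 1 + 2 * ((F.L : ℝ) ^ j / γ) * (24 * (F.L : ℝ) ^ (3 * F.m) * ((F.L : ℝ) ^ j) ^ 3) ≤
        (1 + 2 * γ⁻¹ * (24 * (F.L : ℝ) ^ (3 * F.m))) * ((F.L : ℝ) ^ j) ^ 4 := by
      have : 2 * ((F.L : ℝ) ^ j / γ) * (24 * (F.L : ℝ) ^ (3 * F.m) * ((F.L : ℝ) ^ j) ^ 3) =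
          2 * γ⁻¹ * (24 * (F.L : ℝ) ^ (3 * F.m)) * ((F.L : ℝ) ^ j) ^ 4 := by rw [div_eq_mul_inv]; ring
      rw [this, add_mul, one_mul]
      linarith
    calc (1 + 2 * ((F.L : ℝ) ^ j / γ) * (24 * (F.L : ℝ) ^ (3 * F.m) * ((F.L : ℝ) ^ j) ^ 3)) *
          (24 * (F.L : ℝ) ^ (3 * F.m) * ((F.L : ℝ) ^ j) ^ 3) ^ 2
        ≤ ((1 + 2 * γ⁻¹ * (24 * (F.L : ℝ) ^ (3 * F.m))) * ((F.L : ℝ) ^ j) ^ 4) *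
            (24 * (F.L : ℝ) ^ (3 * F.m) * ((F.L : ℝ) ^ j) ^ 3) ^ 2 := by gcongr
      _ = D * ((F.L : ℝ) ^ j) ^ 10 := by rw [hD]; ring
  calc A * (((F.L : ℝ)⁻¹) ^ 11) ^ j * ((1 + 2 * ((F.L : ℝ) ^ j / γ) * (24 * (F.L : ℝ) ^ (3 * F.m) * ((F.L : ℝ) ^ j) ^ 3)) *
        (24 * (F.L : ℝ) ^ (3 * F.m) * ((F.L : ℝ) ^ j) ^ 3) ^ 2)
      ≤ A * (((F.L : ℝ)⁻¹) ^ 11) ^ j * (D * ((F.L : ℝ) ^ j) ^ 10) := by gcongr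
    _ = A * D * ((((F.L : ℝ)⁻¹) ^ 11) ^ j * ((F.L : ℝ) ^ j) ^ 10) := by ring
    _ = A * D * ((F.L : ℝ)⁻¹) ^ j := by rw [hrj]

/-- **A FLOOR-CLASS TAIL PROFILE DOMINATING THE FINEST-HEIGHT LARGE-FIELD TAILS OF THE RUNS** (`0 < γ ≤ 1`, `0 < b₀`, `1 ≤ p₀`): there is
`η : ℕ → ℝ` (namely `A·L^{−11K}`) with `0 ≤ η`, `Summable η`, summable shifted tails, the floor-class condition
`(∑' k, η (k + j))·((1 + 2(L^j∕γ)·#Plaq_j)·#PBond_j²) → 0`, and `Gibbs_K{U : ¬PlaqSmall θ(K) U} ≤ η K` for every run `K`.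
[cite: Balaban1985UV3, (7) p.257 and (71) p.273] -/
theorem floorTailProfile (F : T3Family) {γ b₀ p₀ : ℝ} (hγ : 0 < γ) (hγ1 : γ ≤ 1) (hb₀ : 0 < b₀) (hp₀ : 1 ≤ p₀) :
    ∃ η : ℕ → ℝ, (∀ j, 0 ≤ η j) ∧ Summable η ∧ (Summable fun i => ∑' k, η (k + i)) ∧
      Tendsto (fun j => (∑' k, η (k + j)) * ((1 + 2 * ((F.L : ℝ) ^ j / γ) * (Fintype.card (Plaq (F.P j) 0) : ℝ)) *
        (Fintype.card (PBond (F.P j) 0) : ℝ) ^ 2)) atTop (𝓝 0) ∧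
      ∀ K, (gibbsK F ℰp γ K).real {U | ¬ PlaqSmall (θBal F.L γ b₀ p₀ K) U} ≤ η K := by
  obtain ⟨A, hA0, hK⟩ := gibbsK_tail_le_geometric F hγ hγ1 hb₀ hp₀
  have hL1 : (1 : ℝ) < F.L := by exact_mod_cast F.hL.2
  have hL0 : (0 : ℝ) < F.L := one_pos.trans hL1
  set r : ℝ := ((F.L : ℝ)⁻¹) ^ 11 with hr
  have hr0 : 0 ≤ r := by positivity
  have hr1 : r < 1 := pow_lt_one₀ (inv_nonneg.mpr hL0.le) (inv_lt_one_of_one_lt₀ hL1) (by norm_num)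
  have h1r : 0 < 1 - r := by linarith
  have htail : ∀ n, (∑' t, A * r ^ (t + n)) = A * (1 - r)⁻¹ * r ^ n := by
    intro n
    have h1 : (fun t => A * r ^ (t + n)) = fun t => (A * r ^ n) * r ^ t := by
      funext t; rw [pow_add]; ring
    rw [h1, tsum_mul_left, tsum_geometric_of_lt_one hr0 hr1]; ring
  refine ⟨fun i => A * r ^ i, fun i => by positivity, (summable_geometric_of_lt_one hr0 hr1).mul_left A, ?_, ?_, hK⟩
  · simp_rw [htail]
    exact (summable_geometric_of_lt_one hr0 hr1).mul_left (A * (1 - r)⁻¹)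
  · simp_rw [htail]
    exact tendsto_geometric_mul_floorBracket F hγ (A * (1 - r)⁻¹) (by positivity)

/-! ## §3 The frame along EVERY printed schedule, and the block of `BackwardStabilityAdmFR` with the floor-class profile -/

/-- **THE FRAME IS INHABITED ALONG EVERY PRINTED SCHEDULE, NOT ONLY A CORNER OF IT**: for all `0 < κ₀`, `M₀`, `0 ≤ C₀` and
`R₀ ≥ 2b₀(2p₀)^{p₀}e^{½−p₀}γ^{1∕4} + 1`, the schedule `printedSchedule F γ b₀ p₀ κ₀ M₀ C₀ R₀` is admissible AND at every height `j` the Wilson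
law of run `j` read at its finest level (`gibbsK F ℰp γ j`, density `boltzmann∕partitionFn`, `κ_j = log partitionFn`) inhabits the ∃κ frame
with parameters `printedSchedule … j` (activity∕vacuum∕slack∕stability budgets `C₀θ_j²`, `C₀`, `C₀L^{−j}`, `C₀` of any size `C₀ ≥ 0` are unused
by the trivial history, not excluded). [cite: Balaban1985UV3, (1) p.256, (5) p.256, (41)-(47) pp.266-267, (67)-(71) p.273] -/
theorem admFR_frame_inhabited_printedSchedule (F : T3Family) {γ b₀ p₀ : ℝ} (hγ : 0 < γ) (hγ1 : γ ≤ 1) (hb₀ : 0 < b₀) (hp₀ : 0 < p₀)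
    {κ₀ : ℝ} (hκ₀ : 0 < κ₀) (M₀ : ℝ) {C₀ R₀ : ℝ} (hC₀ : 0 ≤ C₀)
    (hR₀ : 2 * (b₀ * ((2 * p₀) ^ p₀ * Real.exp (1 / 2 - p₀)) * Real.sqrt (Real.sqrt γ)) + 1 ≤ R₀) :
    AdmissibleClassParams F γ b₀ p₀ (printedSchedule F γ b₀ p₀ κ₀ M₀ C₀ R₀) ∧ ∀ j : ℕ,
      IsProbabilityMeasure (gibbsK F ℰp γ j) ∧
      gibbsK F ℰp γ j = (fieldMeasure _ _ _).withDensity (fun U => ENNReal.ofReal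
        (boltzmann (F.P j) ((F.scheme ℰp γ).β j) U / partitionFn (G := ↥(Matrix.specialUnitaryGroup (Fin 2) ℂ)) (F.P j)
          ((F.scheme ℰp γ).β j))) ∧
      MemAtHeight F ℰp j (printedSchedule F γ b₀ p₀ κ₀ M₀ C₀ R₀ j) (fun U =>
        Real.exp (Real.log (partitionFn (G := ↥(Matrix.specialUnitaryGroup (Fin 2) ℂ)) (F.P j) ((F.scheme ℰp γ).β j))) *
          (boltzmann (F.P j) ((F.scheme ℰp γ).β j) U /
            partitionFn (G := ↥(Matrix.specialUnitaryGroup (Fin 2) ℂ)) (F.P j) ((F.scheme ℰp γ).β j))) := by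
  have hR₀pos : 0 < R₀ := lt_of_lt_of_le (by positivity) hR₀
  refine ⟨printedSchedule_admissible F γ b₀ p₀ hκ₀ M₀ C₀ hR₀pos, fun j => ?_⟩
  have hβj : 0 ≤ (F.scheme ℰp γ).β j := F.scheme_β_nonneg ℰp hγ.le j
  refine ⟨isProbabilityMeasure_gibbsK F ℰp hγ.le j,
    (gibbsK_eq F ℰp γ j).trans (AdmFRFrameInhabited.gibbsMeasure_eq_withDensity _ hβj), ?_⟩
  have hfun : (fun U : GaugeField (F.P j) 0 ↥(Matrix.specialUnitaryGroup (Fin 2) ℂ) =>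
      Real.exp (Real.log (partitionFn (G := ↥(Matrix.specialUnitaryGroup (Fin 2) ℂ)) (F.P j) ((F.scheme ℰp γ).β j))) *
        (boltzmann (F.P j) ((F.scheme ℰp γ).β j) U /
          partitionFn (G := ↥(Matrix.specialUnitaryGroup (Fin 2) ℂ)) (F.P j) ((F.scheme ℰp γ).β j))) =
      boltzmann (G := ↥(Matrix.specialUnitaryGroup (Fin 2) ℂ)) (F.P j) ((F.L : ℝ) ^ j / γ) := by
    funext U; rw [AdmFRFrameInhabited.exp_log_partitionFn_mul _ hβj, AdmFRFrameInhabited.scheme_beta_eq]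
  rw [hfun]
  exact AdmFRFrameInhabited.memAtHeight_boltzmann_printedSchedule F hγ hγ1 hb₀ κ₀ M₀ hC₀
    (fun i => (AdmFRFrameInhabited.two_mul_θBal_le_const F hγ hγ1 hb₀.le hp₀ i).trans hR₀) j

/-- **THE PER-HEIGHT HYPOTHESIS BLOCK OF `BackwardStabilityAdmFR` (stmt-QuantumFields-28294) WITH A FLOOR-CLASS TAIL PROFILE** (`0 < γ ≤ 1`,
`0 < b₀`, `1 ≤ p₀`, every `ω ≥ 0`): an admissible schedule `prm`, a tail profile `η` satisfying ALL FOUR standing conditions of the crux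
(`0 ≤ η`, `Summable η`, summable shifted tails, floor class), and at every height the Wilson law of run `j` read at its finest level
(`μ j = μ' j = gibbsK F ℰp γ j`, `ρ j = ρ' j = boltzmann∕partitionFn`, probability measures) satisfying the block VERBATIM — every standing
hypothesis of the crux on `(prm, ω, η, μ, μ', ρ, ρ')` except the tower consistency `μ j = (descend F ℰp j)_* μ (j+1)`.
[cite: Balaban1985UV3, (1) p.256, (7) p.257, (41)-(47) pp.266-267, (71) p.273] -/
theorem admFR_frame_inhabited_block_floorTail (F : T3Family) (γ : ℝ) (hγ : 0 < γ) (hγ1 : γ ≤ 1) (b₀ p₀ κ : ℝ) (hb₀ : 0 < b₀)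
    (hp₀ : 1 ≤ p₀) (ω : ℕ → ℝ) (hω : ∀ j, 0 ≤ ω j) :
    ∃ prm : ℕ → ClassParams, AdmissibleClassParams F γ b₀ p₀ prm ∧
      ∃ η : ℕ → ℝ, (∀ j, 0 ≤ ω j ∧ 0 ≤ η j) ∧ Summable η ∧ (Summable fun i => ∑' k, η (k + i)) ∧
      Tendsto (fun j => (∑' k, η (k + j)) * ((1 + 2 * ((F.L : ℝ) ^ j / γ) * (Fintype.card (Plaq (F.P j) 0) : ℝ)) *
        (Fintype.card (PBond (F.P j) 0) : ℝ) ^ 2)) atTop (𝓝 0) ∧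
      ∃ (μ μ' : (j : ℕ) → Measure (GaugeField (F.P j) 0 ↥(Matrix.specialUnitaryGroup (Fin 2) ℂ)))
        (ρ ρ' : (j : ℕ) → GaugeField (F.P j) 0 ↥(Matrix.specialUnitaryGroup (Fin 2) ℂ) → ℝ),
        (∀ j, μ j = gibbsK F ℰp γ j ∧ μ' j = μ j ∧ ρ' j = ρ j) ∧
        (∀ j, IsProbabilityMeasure (μ j) ∧ IsProbabilityMeasure (μ' j)) ∧
        ∀ j : ℕ,
          ((∀ U, PlaqSmall (θBal F.L γ b₀ p₀ j) U → 0 < ρ j U ∧ 0 < ρ' j U) ∧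
          μ j = (fieldMeasure _ _ _).withDensity (fun U => ENNReal.ofReal (ρ j U)) ∧
          μ' j = (fieldMeasure _ _ _).withDensity (fun U => ENNReal.ofReal (ρ' j U)) ∧
          (∃ κ : ℝ, MemAtHeight F ℰp j (prm j) (fun U => Real.exp κ * ρ j U)) ∧
          (∃ κ : ℝ, MemAtHeight F ℰp j (prm j) (fun U => Real.exp κ * ρ' j U)) ∧
          (∀ (b b' : PBond (F.P j) 0) U V W Z, PlaqSmall (θBal F.L γ b₀ p₀ j) U → PlaqSmall (θBal F.L γ b₀ p₀ j) V →
            PlaqSmall (θBal F.L γ b₀ p₀ j) W → PlaqSmall (θBal F.L γ b₀ p₀ j) Z → (∀ e, e ≠ b → U e = V e) →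
            (∀ e, e ≠ b' → U e = W e) → (∀ e, e ≠ b' → V e = Z e) → (∀ e, e ≠ b → W e = Z e) →
            |(Real.log (ρ j U) - Real.log (ρ' j U)) - (Real.log (ρ j V) - Real.log (ρ' j V)) -
              ((Real.log (ρ j W) - Real.log (ρ' j W)) - (Real.log (ρ j Z) - Real.log (ρ' j Z)))| ≤
              ω j * Real.exp (-(κ * (b.src.tdist b'.src : ℝ)))) ∧
          μ j {U | ¬ PlaqSmall (θBal F.L γ b₀ p₀ j) U} ≤ ENNReal.ofReal (η j) ∧
          μ' j {U | ¬ PlaqSmall (θBal F.L γ b₀ p₀ j) U} ≤ ENNReal.ofReal (η j) ∧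
          (ContinuousOn (ρ j) {U | PlaqSmall (θBal F.L γ b₀ p₀ j) U} ∧
            ContinuousOn (ρ' j) {U | PlaqSmall (θBal F.L γ b₀ p₀ j) U})) := by
  obtain ⟨prm, hprm, hj⟩ := AdmFRFrameInhabited.admFR_frame_inhabited F γ hγ hγ1 b₀ p₀ hb₀ (one_pos.trans_le hp₀)
  obtain ⟨η, hη0, hηs, hηt, hηf, hηK⟩ := floorTailProfile F hγ hγ1 hb₀ hp₀
  choose μ ρ κj hμ hρ hκ hprob hwd hpos hcont hmem using hj
  refine ⟨prm, hprm, η, fun j => ⟨hω j, hη0 j⟩, hηs, hηt, hηf, μ, μ, ρ, ρ, fun j => ⟨hμ j, rfl, rfl⟩,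
    fun j => ⟨hprob j, hprob j⟩, fun j => ?_⟩
  haveI := hprob j
  have htail : μ j {U | ¬ PlaqSmall (θBal F.L γ b₀ p₀ j) U} ≤ ENNReal.ofReal (η j) := by
    rw [← ofReal_measureReal (measure_ne_top _ _)]
    refine ENNReal.ofReal_le_ofReal ?_
    rw [hμ j]
    exact hηK j
  refine ⟨fun U _ => ⟨hpos j U, hpos j U⟩, hwd j, hwd j, ⟨κj j, hmem j⟩, ⟨κj j, hmem j⟩, ?_, htail, htail,
    ⟨(hcont j).continuousOn, (hcont j).continuousOn⟩⟩
  intro b b' U V W Z _ _ _ _ _ _ _ _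
  have h0 : (Real.log (ρ j U) - Real.log (ρ j U)) - (Real.log (ρ j V) - Real.log (ρ j V)) -
      ((Real.log (ρ j W) - Real.log (ρ j W)) - (Real.log (ρ j Z) - Real.log (ρ j Z))) = 0 := by ring
  rw [h0, abs_zero]
  exact mul_nonneg (hω j) (Real.exp_pos _).le

end Summit.QuantumFields.YangMills.Theorems.AdmFRFrameFloorTail
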